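import Summits.CriticalPhenomena.CardyFormulaZ2.Theorems.CardyBoundaryCoulombGasBoundaryDefectGaussianRStubHoleFreePart1
import Literature.Probability.RandomPlanarGeometry.ExteriorULC

/-!
# Stub `stub_holeFree` of line `rainbow-monomials-in-excursion-kernels` (skeleton v2) — crux `BoundaryDefectGaussianR` (stmt-CriticalPhenomena-14132)

The registered stub HOLEFREE, verbatim: for a Jordan domain `D` whose frontier lies in finitely
many axis-parallel segments, mesh `δ_n → 0⁺` and `V_n = {v ∈ ℤ² : δ_n v ∈ closure D}`,
EVENTUALLY `V_n` is connected for lattice adjacency and `ℤ² ∖ V_n` is connected for king adjacency.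

Proof (grid method; Part 1 = lattice chains and one-dimensional grid stars).
* Grid. The frontier lies on the grid lines `re ∈ X` or `im ∈ Y` (`X`, `Y` = coordinates of the
  vertical / horizontal segments, `hf_frontier_subset_grid`); distinct grid values are `≥ ρ > 0`
  apart (`hf_exists_gap`), and EVENTUALLY `δ_n < ρ` — the only smallness used.
* Stars. The closed star of `ξ` in `X` is `{x | no grid value strictly between x and ξ}`, the open
  star `{x | no grid value ≠ ξ weakly between}`; planar stars are products. Key topological lemma
  `hf_mem_closure_of_stars`: if `A`, `B` are disjoint open sets with `(A ∪ B)ᶜ` on the grid and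
  `p ∈ A`, the closed planar star of `p` lies in `closure A` (a generic open box spanned by `p`
  and a point of the star misses the grid, is convex, meets `A` near `p`, hence lies in `A`).
  Applied to `(Ω, E)` and `(E, Ω)`, `E = (closure Ω)ᶜ` the exterior, which is regular open
  (`hf_interior_closure_exterior`), so open planar stars of exterior points lie in `E`.
* Gluing. `hf_local_to_global` (`IsPreconnected.induction₂'` on `Ω`, resp. on `E`, the latter
  connected by the Jordan curve theorem of the tree, `JordanDomain.isConnected_exterior`): stars
  shrink under perturbation of the centre, contain a lattice point once `δ < ρ`, and the lattice
  points of one star are joined by the box lemma of Part 1 (stars are products of intervals inside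
  `closure Ω`, resp. `E`). Every point of `closure Ω` lies in the closed star of a point of `Ω`
  (`hf_exists_center`); a lattice chain is a king chain.

All [folklore]. Mathlib: `IsPreconnected.induction₂'`, `IsPreconnected.subset_or_subset`,
`Convex.isPreconnected`, `Metric.mem_closure_iff`, `closure_compl`, `interior_compl`.
-/

noncomputable section

open Set Metric Filter Topology

namespace Summit.CriticalPhenomena.CardyFormulaZ2.Cruxes.BoundaryDefectGaussianR.RainbowMonomialsInExcursionKernels

/-! ### Planar stars -/

/-- Planar stars (closed and open) shrink under small perturbation of the centre: coordinatewise
inclusions for `q` close to `p`. [folklore] -/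
theorem hf_stars_subset_of_near (X Y : Finset ℝ) (p : ℂ) : ∃ r > 0, ∀ q : ℂ, dist q p < r →
    ({x : ℝ | ∀ a ∈ X, ¬ (x < a ∧ a < q.re) ∧ ¬ (q.re < a ∧ a < x)} ⊆
      {x : ℝ | ∀ a ∈ X, ¬ (x < a ∧ a < p.re) ∧ ¬ (p.re < a ∧ a < x)} ∧
    {x : ℝ | ∀ a ∈ Y, ¬ (x < a ∧ a < q.im) ∧ ¬ (q.im < a ∧ a < x)} ⊆
      {x : ℝ | ∀ a ∈ Y, ¬ (x < a ∧ a < p.im) ∧ ¬ (p.im < a ∧ a < x)}) ∧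
    ({x : ℝ | ∀ a ∈ X, a ≠ q.re → ¬ (x ≤ a ∧ a ≤ q.re) ∧ ¬ (q.re ≤ a ∧ a ≤ x)} ⊆
      {x : ℝ | ∀ a ∈ X, a ≠ p.re → ¬ (x ≤ a ∧ a ≤ p.re) ∧ ¬ (p.re ≤ a ∧ a ≤ x)} ∧
    {x : ℝ | ∀ a ∈ Y, a ≠ q.im → ¬ (x ≤ a ∧ a ≤ q.im) ∧ ¬ (q.im ≤ a ∧ a ≤ x)} ⊆
      {x : ℝ | ∀ a ∈ Y, a ≠ p.im → ¬ (x ≤ a ∧ a ≤ p.im) ∧ ¬ (p.im ≤ a ∧ a ≤ x)}) := by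
  obtain ⟨r₁, hr₁, h₁⟩ := hf_exists_radius X p.re
  obtain ⟨r₂, hr₂, h₂⟩ := hf_exists_radius Y p.im
  refine ⟨min r₁ r₂, lt_min hr₁ hr₂, fun q hq ↦ ?_⟩
  rw [dist_eq_norm] at hq
  have hre : |q.re - p.re| < r₁ :=
    calc |q.re - p.re| = |(q - p).re| := by simp
      _ ≤ ‖q - p‖ := Complex.abs_re_le_norm _
      _ < r₁ := hq.trans_le (min_le_left _ _)
  have him : |q.im - p.im| < r₂ :=
    calc |q.im - p.im| = |(q - p).im| := by simp
      _ ≤ ‖q - p‖ := Complex.abs_im_le_norm _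
      _ < r₂ := hq.trans_le (min_le_right _ _)
  exact ⟨⟨hf_star_subset_of_near h₁ hre, hf_star_subset_of_near h₂ him⟩,
    ⟨hf_ostar_subset_of_near h₁ hre, hf_ostar_subset_of_near h₂ him⟩⟩

/-- **Open planar stars contain lattice points at fine mesh** (mesh below both grid gaps).
[folklore] -/
theorem hf_exists_lattice_mem_ostars {X Y : Finset ℝ} {ρ₁ ρ₂ δ : ℝ}
    (hgap₁ : ∀ a ∈ X, ∀ a' ∈ X, a ≠ a' → ρ₁ ≤ |a - a'|)
    (hgap₂ : ∀ b ∈ Y, ∀ b' ∈ Y, b ≠ b' → ρ₂ ≤ |b - b'|)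
    (hδ : 0 < δ) (hδ₁ : δ < ρ₁) (hδ₂ : δ < ρ₂) (q : ℂ) :
    ∃ m : ℤ × ℤ, ((m.1 : ℂ) * (δ : ℂ) + (m.2 : ℂ) * (δ : ℂ) * Complex.I).re ∈
        {x : ℝ | ∀ a ∈ X, a ≠ q.re → ¬ (x ≤ a ∧ a ≤ q.re) ∧ ¬ (q.re ≤ a ∧ a ≤ x)} ∧
      ((m.1 : ℂ) * (δ : ℂ) + (m.2 : ℂ) * (δ : ℂ) * Complex.I).im ∈
        {x : ℝ | ∀ a ∈ Y, a ≠ q.im → ¬ (x ≤ a ∧ a ≤ q.im) ∧ ¬ (q.im ≤ a ∧ a ≤ x)} := by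
  obtain ⟨j, hj⟩ := hf_exists_int_mul_mem_ostar hgap₁ hδ hδ₁ q.re
  obtain ⟨k, hk⟩ := hf_exists_int_mul_mem_ostar hgap₂ hδ hδ₂ q.im
  refine ⟨(j, k), ?_, ?_⟩
  · rw [hf_mpos_re]; exact hj
  · rw [hf_mpos_im]; exact hk

/-- Lattice points of the bounding box of two lattice points whose mesh positions have coordinates
in order-connected sets `A`, `B` again have coordinates in `A`, `B`. [folklore] -/
theorem hf_box_mem {A B : Set ℝ} (hA : A.OrdConnected) (hB : B.OrdConnected) {δ : ℝ} (hδ : 0 ≤ δ)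
    {u w m : ℤ × ℤ}
    (hu : ((u.1 : ℂ) * (δ : ℂ) + (u.2 : ℂ) * (δ : ℂ) * Complex.I).re ∈ A ∧
      ((u.1 : ℂ) * (δ : ℂ) + (u.2 : ℂ) * (δ : ℂ) * Complex.I).im ∈ B)
    (hw : ((w.1 : ℂ) * (δ : ℂ) + (w.2 : ℂ) * (δ : ℂ) * Complex.I).re ∈ A ∧
      ((w.1 : ℂ) * (δ : ℂ) + (w.2 : ℂ) * (δ : ℂ) * Complex.I).im ∈ B)
    (h₁ : min u.1 w.1 ≤ m.1) (h₂ : m.1 ≤ max u.1 w.1) (h₃ : min u.2 w.2 ≤ m.2)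
    (h₄ : m.2 ≤ max u.2 w.2) :
    ((m.1 : ℂ) * (δ : ℂ) + (m.2 : ℂ) * (δ : ℂ) * Complex.I).re ∈ A ∧
      ((m.1 : ℂ) * (δ : ℂ) + (m.2 : ℂ) * (δ : ℂ) * Complex.I).im ∈ B := by
  rw [hf_mpos_re, hf_mpos_im] at hu hw ⊢
  exact ⟨hA.uIcc_subset hu.1 hw.1 (hf_mul_mem_uIcc hδ h₁ h₂),
    hB.uIcc_subset hu.2 hw.2 (hf_mul_mem_uIcc hδ h₃ h₄)⟩

/-- A proper convex combination of two distinct reals lies strictly between them. [folklore] -/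
theorem hf_between {a b s : ℝ} (hab : a ≠ b) (hs₀ : 0 < s) (hs₁ : s < 1) :
    a + s * (b - a) ∈ Set.Ioo (min a b) (max a b) := by
  rcases lt_or_gt_of_ne hab with h | h
  · rw [min_eq_left h.le, max_eq_right h.le]; constructor <;> nlinarith
  · rw [min_eq_right h.le, max_eq_left h.le]; constructor <;> nlinarith

/-- Small positive ratios: for `ε > 0` and `c ≥ 0` there is `s ∈ (0, 1)` with `s c < ε`.
[folklore] -/
theorem hf_exists_small_ratio {ε : ℝ} (hε : 0 < ε) {c : ℝ} (hc : 0 ≤ c) :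
    ∃ s : ℝ, 0 < s ∧ s < 1 ∧ s * c < ε := by
  refine ⟨ε / (2 * (c + ε)), by positivity, ?_, ?_⟩
  · rw [div_lt_one (by positivity)]; linarith
  · rw [div_mul_eq_mul_div, div_lt_iff₀ (by positivity)]
    nlinarith [mul_pos hε hε, mul_nonneg hε.le hc]

/-- **Generic perturbation inside a planar star.** A point `z` whose coordinates lie in the closed
stars of the coordinates of `p` can be moved by less than `η` to a point `z'` with the same
property whose coordinates are off the grid and differ from those of `p`. [folklore] -/
theorem hf_exists_perturb2 {X Y : Finset ℝ} {p z : ℂ}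
    (hz₁ : z.re ∈ {x : ℝ | ∀ a ∈ X, ¬ (x < a ∧ a < p.re) ∧ ¬ (p.re < a ∧ a < x)})
    (hz₂ : z.im ∈ {x : ℝ | ∀ a ∈ Y, ¬ (x < a ∧ a < p.im) ∧ ¬ (p.im < a ∧ a < x)})
    {η : ℝ} (hη : 0 < η) : ∃ z' : ℂ, dist z' z < η ∧
      z'.re ∈ {x : ℝ | ∀ a ∈ X, ¬ (x < a ∧ a < p.re) ∧ ¬ (p.re < a ∧ a < x)} ∧
      z'.im ∈ {x : ℝ | ∀ a ∈ Y, ¬ (x < a ∧ a < p.im) ∧ ¬ (p.im < a ∧ a < x)} ∧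
      z'.re ≠ p.re ∧ z'.im ≠ p.im ∧ z'.re ∉ X ∧ z'.im ∉ Y := by
  classical
  obtain ⟨σ₁, hσ₁, r₁, hr₁, h₁⟩ := hf_exists_perturb hz₁
  obtain ⟨σ₂, hσ₂, r₂, hr₂, h₂⟩ := hf_exists_perturb hz₂
  have hσ₁sq : σ₁ * σ₁ = 1 := by rcases hσ₁ with rfl | rfl <;> norm_num
  have hσ₂sq : σ₂ * σ₂ = 1 := by rcases hσ₂ with rfl | rfl <;> norm_num
  have hσ₁abs : |σ₁| = 1 := by rcases hσ₁ with rfl | rfl <;> norm_num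
  have hσ₂abs : |σ₂| = 1 := by rcases hσ₂ with rfl | rfl <;> norm_num
  set F : Finset ℝ := (insert p.re X).image (fun a ↦ σ₁ * (a - z.re)) ∪
    (insert p.im Y).image (fun b ↦ σ₂ * (b - z.im)) with hF
  have hε : (0 : ℝ) < min (min r₁ r₂) (η / 2) := lt_min (lt_min hr₁ hr₂) (half_pos hη)
  obtain ⟨t, ⟨ht₀, ht₁⟩, htF⟩ := (Set.Ioo_infinite hε).exists_notMem_finset F
  have htr₁ : t < r₁ := ht₁.trans_le ((min_le_left _ _).trans (min_le_left _ _))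
  have htr₂ : t < r₂ := ht₁.trans_le ((min_le_left _ _).trans (min_le_right _ _))
  have htη : t < η / 2 := ht₁.trans_le (min_le_right _ _)
  -- the bad values of `t` are in `F`
  have hreF : ∀ a ∈ insert p.re X, z.re + σ₁ * t ≠ a := by
    intro a ha h
    refine htF (Finset.mem_union_left _ (Finset.mem_image.2 ⟨a, ha, ?_⟩))
    calc σ₁ * (a - z.re) = σ₁ * (σ₁ * t) := by rw [← h]; ring
      _ = t := by rw [← mul_assoc, hσ₁sq, one_mul]
  have himF : ∀ b ∈ insert p.im Y, z.im + σ₂ * t ≠ b := by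
    intro b hb h
    refine htF (Finset.mem_union_right _ (Finset.mem_image.2 ⟨b, hb, ?_⟩))
    calc σ₂ * (b - z.im) = σ₂ * (σ₂ * t) := by rw [← h]; ring
      _ = t := by rw [← mul_assoc, hσ₂sq, one_mul]
  refine ⟨⟨z.re + σ₁ * t, z.im + σ₂ * t⟩, ?_, h₁ t ht₀ htr₁, h₂ t ht₀ htr₂,
    hreF _ (Finset.mem_insert_self _ _), himF _ (Finset.mem_insert_self _ _),
    fun h ↦ hreF _ (Finset.mem_insert_of_mem h) rfl,
    fun h ↦ himF _ (Finset.mem_insert_of_mem h) rfl⟩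
  rw [dist_eq_norm]
  have e : (⟨z.re + σ₁ * t, z.im + σ₂ * t⟩ : ℂ) - z = ⟨σ₁ * t, σ₂ * t⟩ :=
    Complex.ext (by simp) (by simp)
  rw [e]
  calc ‖(⟨σ₁ * t, σ₂ * t⟩ : ℂ)‖ ≤ |σ₁ * t| + |σ₂ * t| := Complex.norm_le_abs_re_add_abs_im _
    _ = 2 * t := by rw [abs_mul, abs_mul, hσ₁abs, hσ₂abs, abs_of_pos ht₀]; ring
    _ < η := by linarith

/-! ### The grid and the two complementary domains -/

/-- **Closed stars of points of a domain lie in its closure.** Let `A`, `B` be disjoint open sets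
whose common complement lies on the grid lines `{re ∈ X} ∪ {im ∈ Y}`. If `p ∈ A` and the
coordinates of `z` lie in the closed stars of the coordinates of `p`, then `z ∈ closure A`:
otherwise, after a generic perturbation of `z`, the open box spanned by `p` and `z` misses the
grid, hence lies in `A ∪ B`, is convex and meets `A` near `p`, so lies in `A` — but it also comes
close to `z ∉ closure A`. [folklore] -/
theorem hf_mem_closure_of_stars {X Y : Finset ℝ} {A B : Set ℂ} (hA : IsOpen A) (hB : IsOpen B)
    (hAB : Disjoint A B) (hG : ∀ z, z ∉ A → z ∉ B → z.re ∈ X ∨ z.im ∈ Y) {p : ℂ} (hp : p ∈ A)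
    {z : ℂ} (hz₁ : z.re ∈ {x : ℝ | ∀ a ∈ X, ¬ (x < a ∧ a < p.re) ∧ ¬ (p.re < a ∧ a < x)})
    (hz₂ : z.im ∈ {x : ℝ | ∀ a ∈ Y, ¬ (x < a ∧ a < p.im) ∧ ¬ (p.im < a ∧ a < x)}) :
    z ∈ closure A := by
  by_contra hzc
  obtain ⟨η, hη, hfar⟩ : ∃ η > 0, ∀ b ∈ A, η ≤ dist z b := by
    by_contra hh
    push Not at hh
    exact hzc (Metric.mem_closure_iff.2 fun ε hε ↦
      let ⟨b, hb, hbε⟩ := hh ε hε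
      ⟨b, hb, hbε⟩)
  obtain ⟨z', hzz', hz'₁, hz'₂, hre, him, -, -⟩ := hf_exists_perturb2 hz₁ hz₂ (half_pos hη)
  -- the open box spanned by `p` and `z'`
  set OB : Set ℂ := Complex.re ⁻¹' Set.Ioo (min p.re z'.re) (max p.re z'.re) ∩
    Complex.im ⁻¹' Set.Ioo (min p.im z'.im) (max p.im z'.im) with hOB
  have hconv : Convex ℝ OB := by
    have hc₁ := (convex_Ioo (min p.re z'.re) (max p.re z'.re)).linear_preimage Complex.reLm
    have hc₂ := (convex_Ioo (min p.im z'.im) (max p.im z'.im)).linear_preimage Complex.imLm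
    simp only [Complex.reLm_coe, Complex.imLm_coe] at hc₁ hc₂
    exact hc₁.inter hc₂
  have hOBsub : OB ⊆ A ∪ B := by
    intro w hw
    by_contra hw'
    simp only [Set.mem_union, not_or] at hw'
    rcases hG w hw'.1 hw'.2 with hwX | hwY
    · exact hf_not_mem_Ioo_of_star hz'₁ hwX hw.1
    · exact hf_not_mem_Ioo_of_star hz'₂ hwY hw.2
  -- a point of the box near `p`, inside `A`
  obtain ⟨η', hη', hballA⟩ := Metric.isOpen_iff.1 hA p hp
  obtain ⟨s, hs₀, hs₁, hsd⟩ := hf_exists_small_ratio hη' (norm_nonneg (z' - p))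
  have hy₁OB : p + (s : ℂ) * (z' - p) ∈ OB :=
    ⟨by simpa using hf_between hre.symm hs₀ hs₁, by simpa using hf_between him.symm hs₀ hs₁⟩
  have hy₁A : p + (s : ℂ) * (z' - p) ∈ A := hballA (by
    rw [Metric.mem_ball, dist_eq_norm, add_sub_cancel_left, norm_mul, Complex.norm_real,
      Real.norm_eq_abs, abs_of_pos hs₀]
    exact hsd)
  have hOBA : OB ⊆ A := by
    rcases hconv.isPreconnected.subset_or_subset hA hB hAB hOBsub with h | h
    · exact h
    · exact absurd (h hy₁OB) (Set.disjoint_left.1 hAB hy₁A)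
  -- a point of the box near `z'`, hence near `z`: contradiction
  obtain ⟨s', hs'₀, hs'₁, hs'd⟩ := hf_exists_small_ratio (half_pos hη) (norm_nonneg (p - z'))
  have hy₂OB : z' + (s' : ℂ) * (p - z') ∈ OB := by
    refine ⟨?_, ?_⟩
    · show (z' + (s' : ℂ) * (p - z')).re ∈ Set.Ioo (min p.re z'.re) (max p.re z'.re)
      rw [min_comm, max_comm]; simpa using hf_between hre hs'₀ hs'₁
    · show (z' + (s' : ℂ) * (p - z')).im ∈ Set.Ioo (min p.im z'.im) (max p.im z'.im)
      rw [min_comm, max_comm]; simpa using hf_between him hs'₀ hs'₁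
  have hy₂z : dist z (z' + (s' : ℂ) * (p - z')) < η := by
    calc dist z (z' + (s' : ℂ) * (p - z')) ≤ dist z z' + dist z' (z' + (s' : ℂ) * (p - z')) :=
          dist_triangle _ _ _
      _ = dist z' z + ‖(s' : ℂ) * (p - z')‖ := by
          rw [dist_comm z z']
          congr 1
          rw [dist_eq_norm, sub_add_cancel_left, norm_neg]
      _ < η / 2 + η / 2 := by
          gcongr
          rw [norm_mul, Complex.norm_real, Real.norm_eq_abs, abs_of_pos hs'₀]
          exact hs'd
      _ = η := by ring
  exact (hfar _ (hOBA hy₂OB)).not_gt hy₂z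

/-- The exterior `(closure Ω)ᶜ` of an open set is regular open: it is the interior of its closure.
[folklore] -/
theorem hf_interior_closure_exterior {Ω : Set ℂ} (hΩ : IsOpen Ω) :
    interior (closure (closure Ω)ᶜ) = (closure Ω)ᶜ := by
  rw [closure_compl, interior_compl]
  congr 1
  apply subset_antisymm
  · calc closure (interior (closure Ω)) ⊆ closure (closure Ω) := closure_mono interior_subset
      _ = closure Ω := closure_closure
  · exact closure_mono (interior_maximal subset_closure hΩ)

/-- **Local-to-global gluing of lattice chains along a preconnected set.** Let `O` be preconnected
and `N p` a "star" attached to each point such that (1) stars shrink under small perturbation of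
the centre, (2) the star of every point of `O` contains the mesh position of a lattice point, and
(3) any two lattice points with mesh positions in one star of a point of `O` are joined by a
lattice chain through `S`. Then lattice points of stars of ANY two points of `O` are joined
through `S` (`IsPreconnected.induction₂'`). [folklore] -/
theorem hf_local_to_global {O S : Set ℂ} (hO : IsPreconnected O) (N : ℂ → Set ℂ) (δ : ℝ)
    (hN₁ : ∀ p ∈ O, ∃ r > 0, ∀ q : ℂ, dist q p < r → N q ⊆ N p)
    (hN₂ : ∀ q ∈ O, ∃ m : ℤ × ℤ, ((m.1 : ℂ) * (δ : ℂ) + (m.2 : ℂ) * (δ : ℂ) * Complex.I) ∈ N q)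
    (hN₃ : ∀ p ∈ O, ∀ u w : ℤ × ℤ, ((u.1 : ℂ) * (δ : ℂ) + (u.2 : ℂ) * (δ : ℂ) * Complex.I) ∈ N p →
      ((w.1 : ℂ) * (δ : ℂ) + (w.2 : ℂ) * (δ : ℂ) * Complex.I) ∈ N p →
      Relation.ReflTransGen (fun b c : ℤ × ℤ ↦
        ((b.1 : ℂ) * (δ : ℂ) + (b.2 : ℂ) * (δ : ℂ) * Complex.I) ∈ S ∧
        ((c.1 : ℂ) * (δ : ℂ) + (c.2 : ℂ) * (δ : ℂ) * Complex.I) ∈ S ∧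
        (b.1 - c.1) ^ 2 + (b.2 - c.2) ^ 2 = 1) u w)
    {p q : ℂ} (hp : p ∈ O) (hq : q ∈ O) {u w : ℤ × ℤ}
    (hu : ((u.1 : ℂ) * (δ : ℂ) + (u.2 : ℂ) * (δ : ℂ) * Complex.I) ∈ N p)
    (hw : ((w.1 : ℂ) * (δ : ℂ) + (w.2 : ℂ) * (δ : ℂ) * Complex.I) ∈ N q) :
    Relation.ReflTransGen (fun b c : ℤ × ℤ ↦
      ((b.1 : ℂ) * (δ : ℂ) + (b.2 : ℂ) * (δ : ℂ) * Complex.I) ∈ S ∧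
      ((c.1 : ℂ) * (δ : ℂ) + (c.2 : ℂ) * (δ : ℂ) * Complex.I) ∈ S ∧
      (b.1 - c.1) ^ 2 + (b.2 - c.2) ^ 2 = 1) u w := by
  have key := hO.induction₂' (fun p q ↦ ∀ u w : ℤ × ℤ,
    ((u.1 : ℂ) * (δ : ℂ) + (u.2 : ℂ) * (δ : ℂ) * Complex.I) ∈ N p →
    ((w.1 : ℂ) * (δ : ℂ) + (w.2 : ℂ) * (δ : ℂ) * Complex.I) ∈ N q →
    Relation.ReflTransGen (fun b c : ℤ × ℤ ↦
      ((b.1 : ℂ) * (δ : ℂ) + (b.2 : ℂ) * (δ : ℂ) * Complex.I) ∈ S ∧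
      ((c.1 : ℂ) * (δ : ℂ) + (c.2 : ℂ) * (δ : ℂ) * Complex.I) ∈ S ∧
      (b.1 - c.1) ^ 2 + (b.2 - c.2) ^ 2 = 1) u w) ?_ ?_ hp hq
  · exact key u w hu hw
  · intro x hx
    obtain ⟨r, hr, hsub⟩ := hN₁ x hx
    filter_upwards [mem_nhdsWithin_of_mem_nhds (Metric.ball_mem_nhds x hr)] with y hy
    exact ⟨fun u w hu hw ↦ hN₃ x hx u w hu (hsub y hy hw),
      fun u w hu hw ↦ hN₃ x hx u w (hsub y hy hu) hw⟩
  · intro x y z _ hy _ hxy hyz u w hu hw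
    obtain ⟨m, hm⟩ := hN₂ y hy
    exact (hxy u m hu hm).trans (hyz m w hm hw)

/-- Every point of the closure of `O` has its coordinates in the closed stars of the coordinates
of some point of `O`. [folklore] -/
theorem hf_exists_center (X Y : Finset ℝ) {O : Set ℂ} {z : ℂ} (hz : z ∈ closure O) :
    ∃ p ∈ O, z.re ∈ {x : ℝ | ∀ a ∈ X, ¬ (x < a ∧ a < p.re) ∧ ¬ (p.re < a ∧ a < x)} ∧
      z.im ∈ {x : ℝ | ∀ a ∈ Y, ¬ (x < a ∧ a < p.im) ∧ ¬ (p.im < a ∧ a < x)} := by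
  obtain ⟨r, hr, hsub⟩ := hf_stars_subset_of_near X Y z
  obtain ⟨p, hp, hpz⟩ := Metric.mem_closure_iff.1 hz r hr
  refine ⟨p, hp, ?_⟩
  obtain ⟨⟨h₁, h₂⟩, -⟩ := hsub p (by rwa [dist_comm])
  exact ⟨hf_star_comm.1 (h₁ (hf_star_self X p.re)), hf_star_comm.1 (h₂ (hf_star_self Y p.im))⟩

/-- The frontier of a set whose frontier lies in finitely many axis-parallel segments lies on
finitely many grid lines: `re z ∈ X` or `im z ∈ Y` with `X`, `Y` the coordinates of the first
endpoints of the vertical, resp. horizontal, segments. [folklore] -/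
theorem hf_frontier_subset_grid {Ω : Set ℂ} {T : Finset (ℂ × ℂ)}
    (hax : ∀ q ∈ T, q.1.re = q.2.re ∨ q.1.im = q.2.im)
    (hfr : frontier Ω ⊆ ⋃ q ∈ T, segment ℝ q.1 q.2) {z : ℂ} (hz : z ∈ frontier Ω) :
    z.re ∈ T.image (fun q ↦ q.1.re) ∨ z.im ∈ T.image (fun q ↦ q.1.im) := by
  obtain ⟨q, hq, hzq⟩ := Set.mem_iUnion₂.1 (hfr hz)
  obtain ⟨a, b, -, -, hab, rfl⟩ := hzq
  rcases hax q hq with h | h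
  · refine Or.inl (Finset.mem_image.2 ⟨q, hq, ?_⟩)
    have e : (a • q.1 + b • q.2).re = a * q.1.re + b * q.2.re := by simp
    rw [e, ← h, ← add_mul, hab, one_mul]
  · refine Or.inr (Finset.mem_image.2 ⟨q, hq, ?_⟩)
    have e : (a • q.1 + b • q.2).im = a * q.1.im + b * q.2.im := by simp
    rw [e, ← h, ← add_mul, hab, one_mul]

/-- **Stub (v2) — lattice approximations of rectilinear Jordan domains are eventually connected and hole-free (HOLEFREE).** For a Jordan domain whose frontier lies in finitely many axis-parallel segments, mesh `δ_n → 0⁺` and `V_n = {v : δ_n v ∈ closure D}`: eventually `V_n` is connected for lattice adjacency and `ℤ² ∖ V_n` is connected for king adjacency (the hypotheses of the corrected cluster-locality stub at `V = V_n`). [folklore] -/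
theorem stub_holeFree : ∀ (D : Literature.Probability.RandomPlanarGeometry.JordanDomain), (∃ S : Finset (ℂ × ℂ), (∀ q ∈ S, q.1.re = q.2.re ∨ q.1.im = q.2.im) ∧ frontier D.carrier ⊆ ⋃ q ∈ S, segment ℝ q.1 q.2) → ∀ (δ : ℕ → ℝ), (∀ n, 0 < δ n) → Filter.Tendsto δ Filter.atTop (nhds 0) → ∀ (V : ℕ → Finset (ℤ × ℤ)), (∀ n, ∀ v : ℤ × ℤ, v ∈ V n ↔ (((v).1 : ℂ) * ((δ n : ℝ) : ℂ) + ((v).2 : ℂ) * ((δ n : ℝ) : ℂ) * Complex.I) ∈ closure D.carrier) → ∀ᶠ n in Filter.atTop, (∀ u ∈ V n, ∀ w ∈ V n, Relation.ReflTransGen (fun b c : ℤ × ℤ ↦ b ∈ V n ∧ c ∈ V n ∧ (b.1 - c.1) ^ 2 + (b.2 - c.2) ^ 2 = 1) u w) ∧ (∀ u ∉ V n, ∀ w ∉ V n, Relation.ReflTransGen (fun b c : ℤ × ℤ ↦ b ∉ V n ∧ c ∉ V n ∧ max |b.1 - c.1| |b.2 - c.2| ≤ 1) u w) := by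
  intro D hS δ hδpos hδ0 V hV
  obtain ⟨T, hax, hfr⟩ := hS
  classical
  set Ω : Set ℂ := D.carrier with hΩ
  set X : Finset ℝ := T.image (fun q ↦ q.1.re) with hX
  set Y : Finset ℝ := T.image (fun q ↦ q.1.im) with hY
  have hΩo : IsOpen Ω := D.isOpen
  have hEo : IsOpen (closure Ω)ᶜ := isClosed_closure.isOpen_compl
  have hdisj : Disjoint Ω (closure Ω)ᶜ := disjoint_compl_right.mono_left subset_closure
  -- off `Ω` and off the exterior means on the frontier, hence on the grid
  have hG : ∀ z, z ∉ Ω → z ∉ (closure Ω)ᶜ → z.re ∈ X ∨ z.im ∈ Y := by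
    intro z hzΩ hzE
    have hzf : z ∈ frontier Ω := by
      rw [hΩo.frontier_eq]
      exact ⟨not_notMem.1 hzE, hzΩ⟩
    exact hf_frontier_subset_grid hax hfr hzf
  have hG' : ∀ z, z ∉ (closure Ω)ᶜ → z ∉ Ω → z.re ∈ X ∨ z.im ∈ Y :=
    fun z hzE hzΩ ↦ hG z hzΩ hzE
  obtain ⟨ρ₁, hρ₁, hgap₁⟩ := hf_exists_gap X
  obtain ⟨ρ₂, hρ₂, hgap₂⟩ := hf_exists_gap Y
  have hev : ∀ᶠ n in Filter.atTop, δ n < min ρ₁ ρ₂ := hδ0 (Iio_mem_nhds (lt_min hρ₁ hρ₂))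
  filter_upwards [hev] with n hn
  have hd : 0 < δ n := hδpos n
  have hd₁ : δ n < ρ₁ := hn.trans_le (min_le_left _ _)
  have hd₂ : δ n < ρ₂ := hn.trans_le (min_le_right _ _)
  constructor
  · -- `V n` is lattice-connected: chains through `closure Ω`, glued along `Ω` (closed stars)
    intro u hu w hw
    obtain ⟨p, hp, hup⟩ := hf_exists_center X Y ((hV n u).1 hu)
    obtain ⟨q, hq, hwq⟩ := hf_exists_center X Y ((hV n w).1 hw)
    have main := hf_local_to_global (S := closure Ω) D.isConnected.isPreconnected
      (fun p ↦ {z : ℂ | z.re ∈ {x : ℝ | ∀ a ∈ X, ¬ (x < a ∧ a < p.re) ∧ ¬ (p.re < a ∧ a < x)} ∧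
        z.im ∈ {x : ℝ | ∀ a ∈ Y, ¬ (x < a ∧ a < p.im) ∧ ¬ (p.im < a ∧ a < x)}}) (δ n)
      (fun p _ ↦ ?_) (fun q _ ↦ ?_) (fun p hp u w hu hw ↦ ?_) hp hq hup hwq
    · exact hf_chain_mono (fun b c hb hc hbc ↦ ⟨(hV n b).2 hb, (hV n c).2 hc, hbc⟩) main
    · obtain ⟨r, hr, h⟩ := hf_stars_subset_of_near X Y p
      exact ⟨r, hr, fun q hq z hz ↦ ⟨(h q hq).1.1 hz.1, (h q hq).1.2 hz.2⟩⟩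
    · obtain ⟨m, hm₁, hm₂⟩ := hf_exists_lattice_mem_ostars hgap₁ hgap₂ hd hd₁ hd₂ q
      exact ⟨m, hf_ostar_subset_star X q.re hm₁, hf_ostar_subset_star Y q.im hm₂⟩
    · refine hf_chain_box u w fun m h₁ h₂ h₃ h₄ ↦ ?_
      have hm := hf_box_mem (hf_star_ordConnected X p.re) (hf_star_ordConnected Y p.im) hd.le
        hu hw h₁ h₂ h₃ h₄
      exact hf_mem_closure_of_stars hΩo hEo hdisj hG hp hm.1 hm.2
  · -- the complement is king-connected: chains through the exterior, glued along it (open stars)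
    intro u hu w hw
    have hu' : ((u.1 : ℂ) * ((δ n : ℝ) : ℂ) + (u.2 : ℂ) * ((δ n : ℝ) : ℂ) * Complex.I) ∈
        (closure Ω)ᶜ := fun h ↦ hu ((hV n u).2 h)
    have hw' : ((w.1 : ℂ) * ((δ n : ℝ) : ℂ) + (w.2 : ℂ) * ((δ n : ℝ) : ℂ) * Complex.I) ∈
        (closure Ω)ᶜ := fun h ↦ hw ((hV n w).2 h)
    -- open stars of exterior points lie in the exterior
    have hostar : ∀ p ∈ (closure Ω)ᶜ, ∀ z : ℂ,
        z.re ∈ {x : ℝ | ∀ a ∈ X, a ≠ p.re → ¬ (x ≤ a ∧ a ≤ p.re) ∧ ¬ (p.re ≤ a ∧ a ≤ x)} →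
        z.im ∈ {x : ℝ | ∀ a ∈ Y, a ≠ p.im → ¬ (x ≤ a ∧ a ≤ p.im) ∧ ¬ (p.im ≤ a ∧ a ≤ x)} →
        z ∈ (closure Ω)ᶜ := by
      intro p hp
      have h3 : IsOpen {z : ℂ |
          z.re ∈ {x : ℝ | ∀ a ∈ X, a ≠ p.re → ¬ (x ≤ a ∧ a ≤ p.re) ∧ ¬ (p.re ≤ a ∧ a ≤ x)} ∧
          z.im ∈ {x : ℝ | ∀ a ∈ Y, a ≠ p.im → ¬ (x ≤ a ∧ a ≤ p.im) ∧ ¬ (p.im ≤ a ∧ a ≤ x)}} :=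
        ((hf_ostar_isOpen X p.re).preimage Complex.continuous_re).inter
          ((hf_ostar_isOpen Y p.im).preimage Complex.continuous_im)
      have h4 := (h3.subset_interior_iff (t := closure (closure Ω)ᶜ)).2 (fun z hz ↦
        hf_mem_closure_of_stars hEo hΩo hdisj.symm hG' hp (hf_ostar_subset_star X p.re hz.1)
          (hf_ostar_subset_star Y p.im hz.2))
      rw [hf_interior_closure_exterior hΩo] at h4
      exact fun z hz₁ hz₂ ↦ h4 ⟨hz₁, hz₂⟩
    have main := hf_local_to_global (S := (closure Ω)ᶜ) D.isConnected_exterior.isPreconnected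
      (fun p ↦ {z : ℂ |
        z.re ∈ {x : ℝ | ∀ a ∈ X, a ≠ p.re → ¬ (x ≤ a ∧ a ≤ p.re) ∧ ¬ (p.re ≤ a ∧ a ≤ x)} ∧
        z.im ∈ {x : ℝ | ∀ a ∈ Y, a ≠ p.im → ¬ (x ≤ a ∧ a ≤ p.im) ∧ ¬ (p.im ≤ a ∧ a ≤ x)}})
      (δ n) (fun p _ ↦ ?_) (fun q _ ↦ hf_exists_lattice_mem_ostars hgap₁ hgap₂ hd hd₁ hd₂ q)
      (fun p hp u w hu hw ↦ ?_) hu' hw'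
      ⟨hf_ostar_self X _, hf_ostar_self Y _⟩ ⟨hf_ostar_self X _, hf_ostar_self Y _⟩
    · exact hf_chain_mono (fun b c hb hc hbc ↦
        ⟨fun h ↦ hb ((hV n b).1 h), fun h ↦ hc ((hV n c).1 h), hf_king_of_latt hbc⟩) main
    · obtain ⟨r, hr, h⟩ := hf_stars_subset_of_near X Y p
      exact ⟨r, hr, fun q hq z hz ↦ ⟨(h q hq).2.1 hz.1, (h q hq).2.2 hz.2⟩⟩
    · refine hf_chain_box u w fun m h₁ h₂ h₃ h₄ ↦ ?_
      have hm := hf_box_mem (hf_ostar_ordConnected X p.re) (hf_ostar_ordConnected Y p.im) hd.le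
        hu hw h₁ h₂ h₃ h₄
      exact hostar p hp _ hm.1 hm.2

end Summit.CriticalPhenomena.CardyFormulaZ2.Cruxes.BoundaryDefectGaussianR.RainbowMonomialsInExcursionKernels

end
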